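import Summits.QuantumFields.BalabanUV.T4Continuum.Support.NE9LinSizeEnd
import Summits.QuantumFields.BalabanUV.T4Continuum.Support.NE9Lemma1Gain
import Summits.QuantumFields.BalabanUV.T4Continuum.Support.NE9LinSizeEndBudget

/-!
# NE9LinSizeEndPieceGain — E5′-πG / E5′-πβ: the d-currency torus END face of row NE9 at the piece form of the history channel WITH A
GENERAL GAIN, and at the (4.30)-species letter **`ω = L^{−β}`** (β > 0 the Hölder exponent of [I] (3.32)/(4.18)) — the row
owner's located correction O-ne9p1g23-1 / ruling l.7710 (E) «RATE LETTER ω := L^{−α}, NOT L⁻¹» applied to the face E5′-π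
(cell `pub-balaban`, T4-DAG §2 node U3 / §6 NE9; rung (B)+1 on a FIXED finite T⁴; NE9 formalisation crew, unit
`b2b-balaban-t4-ne9-formalise-leaf-07` gen 3; sibling of `NE9LinSizeEndPiece` (E5′-π, the DISPLAYED ℓ⁵ / `ω = L⁻¹` species);
composition BY NAME of leaf-10-g2's E5′ (p209889) with t4-ne9-p1-g23's `NE9Lemma1Gain` (p211097); nothing of either modified)

HONEST FRAMING (T4-DAG PAGE 1).  Rung (B)+1 = existence and uniqueness of the ε → 0 limit of gauge-invariant observables on a
FIXED finite torus T⁴ — NOT infinite volume, NOT a mass gap, NOT the Clay problem.  NE9 is a cell NEW ESTIMATE, NOT PRINTED and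
NOT discharged here.  DISPLAYED: ONE per-piece bound `PieceBoundG … gain` (the (1.24)×(1.25) shape with the gain `(L^jη)^{4+α}`
of [I] (0.29) — PROOF-INTERIOR of [I] §§3–5, residual class (R-2); models the channel fed marginal-free packages, O-ne9p1g22-1),
the counts `LevelCountsG` (□′-count against `c_Q·ω^{k−j}`), `SrcScale`, `Factorises`/`LastCouplingLipschitz`, and every activity /
geometry / (A″) / (L‴) binder of E5′ VERBATIM.  0 `def`, 0 `sorry`, no END re-wired; [I]/[II] locators are TYPE locators
(ABSOLUTE RULE); `FlowStep.BetaPertH`, (B), (B^μ) do not occur.  HONEST DEPENDENCY (verbatim): continuum YM on T⁴ ⇐ BetaPertH ∧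
nine spine estimates (0/9 proved); BetaPertH ⇐ (D1) ∧ (D4) ∧ CAP+tail; G-an2-4 gates asym, D1 and NE2/3/4.

WHY (FINDING F-ne9p1g23-1, renders [I] p010/p029/p037/p038/p040 per the owner).  The per-creation-step gain of the localized
curly bracket on marginal-free inputs is the exponent α of [I] (0.29) «|𝐕^{(j)}| ≦ O(1)(L^jη)^{4+α}», and for the (4.30)-species
α = β < 1 ([I] (4.18) p. 285 «0 ≦ β ≦ β₀ < 1», p. 288 «with a positive β … the power 4 + β instead of 5»); [II] p. 8 l. 9–10's
«(6L)⁴L^jη» is the displayed fifth-order species only.  All END faces are parametric in ω, so nothing structural changes; the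
rate LETTER does: `ω = L^{−β}`, j-summed companion `c_Q(1 − L^{−β})⁻¹` ((0.30)).

WHAT IS PROVED (kernel).
§3 **E5′-πG `torus_termSize_ne9_and_fadingMemory_of_linSizeDischargers_pieceGain`** — E5′ at `T := pieceChannel Pc`,
   `τ := tauOfG c_Q (agePow ω)`: S3/S5/profile/`hpos` DISCHARGED (`channelAdditive_piece`, `channelStepSum_piece`,
   `channelSizeAtStepNN_pieceG_profile`); rate **`μ = ω + 4·lipbar·(a₁·e^{−a″(ν+1)})·c_Q`**, `ω > 0` a parameter;
   **E5′-πβ `…_pieceHolder`** — the (4.30)-species `ω := L^{−β}` (`Real.rpow`; `0 < L^{−β} < 1` by `rpow_neg_pos_lt_one`):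
   **`μ_β = L^{−β} + 4·lipbar·(a₁·e^{−a″(ν+1)})·c_Q`**.
§4 N2 ON THESE LETTERS (BY NAME from N2-ter §C `NE9LinSizeEndBudget`): `fade_pieceHolder_iff_log_lt` — for `L > 1`, `β > 0` and a
   positive product, `μ_β < 1 ↔ log(4·lipbar·a₁·c_Q/(1 − L^{−β})) < a″(ν+1)` (TYPE «κ sufficiently large»; the gap `1 − L^{−β}` ↓ 0
   as β ↓ 0 — p. 288's «positive β» is used STRICTLY); `fade_pieceHolder_of_kappa_threshold` (with the face's `κ ≤ a″`);
   `fade_necessary_pieceHolder` (polynomial smallness `… ·α4·ε′·c_Q < 1 − L^{−β}`); `holderGap_antitone` (β ≤ β′ ⇒ 1 − L^{−β} ≤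
   1 − L^{−β′}: a threshold valid at the smallest declared β is valid on the whole declared range); `not_fade_at_holder_zero`.
   The certified β-tables are the (w6) AMENDMENT's (leaf-10-g3, `NE9FadingArithmeticHolder`); nothing numeric about β is asserted.
DISGUISE TEST as for E5′-π: one-history statements about a linear channel of ONE run; S5 is the fading SOURCE, not NE9.

References (TYPE locators only; nothing printed is a hypothesis): T. Bałaban, CMP **109** (1987) [Balaban1987RG1] (0.23) p. 256,
(0.28)–(0.30) p. 258, (1.18) p. 263, Thm 3 p. 264, (3.32) p. 276, (4.18) p. 285, (4.22) p. 285, p. 288; CMP **116** (1988)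
[Balaban1988RG2Cluster] (1.23)–(1.29) pp. 7–8, (1.33)–(1.36) p. 9, p. 18 text, (2.27) p. 18, (2.38) p. 20, (2.41) p. 21;
R. Kotecký, D. Preiss, CMP **103** (1986) [KoteckyPreiss1986].
-/

noncomputable section

namespace Summit.QuantumFields.BalabanUV.T4Continuum.NE9LinSizeEndPieceGain

open scoped BigOperators
open Metric Set MeasureTheory BoundedContinuousFunction
open Literature.Probability.LatticeModels
open Literature.MathematicalPhysics.QuantumFieldTheory
open Literature.MathematicalPhysics.QuantumFieldTheory.Balaban1983to89
open Literature.MathematicalPhysics.QuantumFieldTheory.Balaban1983to89.T4OutputRate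
open Literature.MathematicalPhysics.QuantumFieldTheory.Balaban1983to89.T4ActivityLipschitz
open Literature.MathematicalPhysics.QuantumFieldTheory.Balaban1983to89.T4HistoryLipschitzRecursion
open Literature.MathematicalPhysics.QuantumFieldTheory.Balaban1983to89.T4HistoryLipschitzOuter
open Literature.MathematicalPhysics.QuantumFieldTheory.Balaban1983to89.T4HistoryLipschitzActivity
open Literature.MathematicalPhysics.QuantumFieldTheory.Balaban1983to89.T4HistoryLipschitzEntropy
open Literature.MathematicalPhysics.QuantumFieldTheory.Balaban1983to89.T4HistoryLipschitzCubeGeometry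
open Literature.MathematicalPhysics.QuantumFieldTheory.Balaban1983to89.T4HistoryLipschitzActivity (ClusterGeom)
open Literature.MathematicalPhysics.QuantumFieldTheory.Balaban1983to89.T4HistoryLipschitzSegment
open Literature.MathematicalPhysics.QuantumFieldTheory.Balaban1983to89.T4HistoryLipschitzLinearSize
open Summit.QuantumFields.BalabanUV.T4Continuum.NE9Lemma1Counting
open Summit.QuantumFields.BalabanUV.T4Continuum.NE9Lemma1Gain
open Summit.QuantumFields.BalabanUV.T4Continuum.NE9LinSizeEnd
open Summit.QuantumFields.BalabanUV.T4Continuum.NE9LinSizeEndBudget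

/-! ## §3 E5′-πG / E5′-πβ: the general gain and the (4.30)-species `ω = L^{−β}` (owner ruling l.7710, O-ne9p1g23-1) -/

section Gain

variable {ν N : ℕ} {C : Carriers} {D : ℕ}
variable {Bg : Type} {Sp : Type*} [TopologicalSpace Sp] [MeasurableSpace Sp] [OpensMeasurableSpace Sp] {F : Type*}
  [Fintype F] {Ω : Type*} [MeasurableSpace Ω]

/-- **E5′-πG — E5′ AT THE PIECE FORM WITH A GENERAL GAIN (kernel composition BY NAME; the owner's located correction
O-ne9p1g23-1).**  `NE9LinSizeEnd.torus_termSize_ne9_and_fadingMemory_of_linSizeDischargers` at `T := pieceChannel Pc`,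
`wt := weightOf Pc κ₁ d0 O1 Kp`, `τ := tauOfG cQ (agePow ω)`: S3 by `channelAdditive_piece`/`channelStepSum_piece`, S5 + profile by
`channelSizeAtStepNN_pieceG_profile` from ONE displayed per-piece bound `PieceBoundG … gain` ([I] (0.29) «|𝐕^{(j)}| ≦ O(1)(L^jη)^{4+α}»
with the count `LevelCountsG.countQ : card(□′)·gain ≤ c_Q·ω^{k−j}`), so **`τ̄ = c_Q`** and the contraction letter **`ω`** is a
PARAMETER (`0 < ω`; the (4.30)-species has `ω = L^{−β}`, `0 < β < 1`, [I] (4.18) p. 285 / p. 288 — see `…_pieceHolder`); `hpos`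
derived.  Conclusion: `TermSize` and the root with rate letter **`μ = ω + 4·lipbar·(a₁·e^{−a″(ν+1)})·c_Q`**.
[cite: Balaban1987RG1, (0.29)-(0.30) p.258, (4.18) p.285, p.288; Balaban1988RG2Cluster, (1.23)-(1.29) pp.7-8, (1.33) p.9, (2.27) p.18, (2.38) p.20, (2.41) p.21; KoteckyPreiss1986, (1)-(3)] -/
theorem torus_termSize_ne9_and_fadingMemory_of_linSizeDischargers_pieceGain
    (Γ : CubeChart C (Fin ν → ZMod N) (torusAdj ν N) D) {ι αi βi γi : Type} (Pc : PieceData C Bg ι αi βi γi)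
    {E : Functional C Bg} {W : Set (ℕ → ℝ)} {Adm : Set (Bg → C.Dom → ℝ)} {Ψ : ℕ → ℝ → (ι → ℝ) → Bg → C.Dom → ℝ}
    {μ : ℕ → ℝ → Bg → Finset (Fin ν → ZMod N) → Measure Ω} {pre : ℕ → ℝ → Bg → Finset (Fin ν → ZMod N) → Ω → ℂ}
    {c : ℕ → ℝ → Bg → Finset (Fin ν → ZMod N) → Ω → F → ℂ}
    {pt : ℕ → ℝ → Bg → Finset (Fin ν → ZMod N) → Ω → F → Sp} {β : ℕ → Sp → ℝ}
    {dom : ℕ → Finset (Fin ν → ZMod N) → F → Finset (Fin ν → ZMod N)}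
    {lip ε' α4 : ℕ → ℝ} {a₁ a'' κ κ₁ d0 O1 cQ ω lipbar ℓ a a' : ℝ} {Kp : ℕ → ι → ℝ} {gain : ℕ → ℕ → ℝ}
    {lam p₀ Nsz : ℕ → ℝ}
    (ρ : ℕ → (ι → ℝ) → (Sp →ᵇ ℂ))
    (h0 : ScaleZeroFree E W) (hAdm : AdmissibleTerms E W Adm) (hres : AdmRestrict Adm)
    -- the piece form with a general gain: source discipline, ONE per-piece bound, the level counts, the letter 0 < ω
    (hsrc : SrcScale Pc) (hPiece : PieceBoundG Pc κ κ₁ d0 Kp gain) (hLev : LevelCountsG Pc κ κ₁ O1 cQ gain (agePow ω))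
    (hKp : ∀ k y, 0 ≤ Kp k y) (hO1 : 0 ≤ O1) (hgain : ∀ k j, 0 ≤ gain k j) (hcQ : 0 ≤ cQ) (hω : 0 < ω)
    -- E5′'s remaining recursion-side binders at `T := pieceChannel Pc`, `wt := weightOf …`, `τ := tauOfG cQ (agePow ω)`
    (hfac : Factorises E W (pieceChannel Pc) Ψ) (hlast : LastCouplingLipschitz E W (pieceChannel Pc) Ψ κ lam)
    (hρ : ∀ (k : ℕ) (Q Q' : ι → ℝ) (M : ℝ), (∀ y, |Q y - Q' y| ≤ weightOf Pc κ₁ d0 O1 Kp k y * M) → ‖ρ k Q - ρ k Q'‖ ≤ M)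
    (hΨ : ∀ (k : ℕ) (s : ℝ) (Q Q' : ι → ℝ) (U : Bg) (X : C.Dom),
      Ψ k s Q U X - Ψ k s Q' U X =
        (Γ.geom.newTerm (Γ.geom.avgExpLinearAct μ pre fun k s U γ ω => evalFunctional (c k s U γ ω) (pt k s U γ ω))
            k s U X (ρ k Q) -
          Γ.geom.newTerm (Γ.geom.avgExpLinearAct μ pre fun k s U γ ω => evalFunctional (c k s U γ ω) (pt k s U γ ω))
            k s U X (ρ k Q')).re)
    (hexpl : ∀ g ∈ W, ∀ (k : ℕ) (Q : ι → ℝ) (U : Bg) (X : C.Dom), C.scale X = k + 1 →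
      |Ψ k (g k) Q U X -
          (Γ.geom.newTerm (Γ.geom.avgExpLinearAct μ pre fun k s U γ ω => evalFunctional (c k s U γ ω) (pt k s U γ ω))
            k (g k) U X (ρ k Q)).re| ≤ Real.exp (-(κ * C.d X)) * p₀ k)
    (hbase : ∀ g ∈ W, ∀ (U : Bg) (X : C.Dom), C.scale X = 0 → |E g U X| ≤ Real.exp (-(κ * C.d X)) * Nsz 0)
    (hNsucc : ∀ j, p₀ j + a₁ * Real.exp (-(a'' * (ν + 1))) ≤ Nsz (j + 1)) (hNnn : ∀ j, 0 ≤ Nsz j)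
    (hbox : ∀ (k : ℕ) (Q : ι → ℝ),
      (∀ y, |Q y| ≤ weightOf Pc κ₁ d0 O1 Kp k y * sizeRadius (tauOfG cQ (agePow ω)) Nsz k) → ∀ x, ‖ρ k Q x‖ ≤ β k x)
    (hpre : ∀ k s U γ, AEStronglyMeasurable (pre k s U γ) (μ k s U γ))
    (hc : ∀ k s U γ Y, AEStronglyMeasurable (fun ω => c k s U γ ω Y) (μ k s U γ))
    (hpt : ∀ k s U γ Y, Measurable fun ω => pt k s U γ ω Y) (hlip : ∀ k, 0 < lip k) (hlipb : ∀ k, lip k ≤ lipbar)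
    (hint₀ : ∀ k s U γ, Integrable (fun ω => ‖pre k s U γ ω‖ * Real.exp (boxExponent c pt β k s U γ ω)) (μ k s U γ))
    (hmeet : ∀ k s U (γ : Finset (Fin ν → ZMod N)) ω Y, c k s U γ ω Y ≠ 0 → ∃ x ∈ γ, x ∈ dom k γ Y)
    (hα4 : ∀ k, 0 ≤ α4 k) (ha : (2:ℝ) ^ ν * Real.log 2 + Real.log (8 * ν) ≤ a)
    (hliplb : ∀ k, α4 k * 2 ^ (ν + 1 + 2 ^ ν) ≤ lip k)
    (hlin : ∀ k s U (γ : Finset (Fin ν → ZMod N)) ω Y,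
      ‖c k s U γ ω Y‖ ≤ α4 k * Real.exp (-(a * (linSize (dom k γ Y) : ℝ))))
    (hdomconn : ∀ k (γ : Finset (Fin ν → ZMod N)) Y, (dom k γ Y).Nonempty →
      ∃ b ∈ dom k γ Y, Polymer.IsConn (torusAdj ν N) (dom k γ Y) b)
    (hdominj : ∀ k (γ : Finset (Fin ν → ZMod N)), Set.InjOn (dom k γ) {Y | (dom k γ Y).Nonempty})
    (hXconn : ∀ X, ∃ b, Polymer.IsConn (torusAdj ν N) (Γ.cubes X) b)
    (hcmp : ∀ X, κ * C.d X ≤ a'' * (linSize (Γ.cubes X) : ℝ))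
    (hε' : ∀ k, 0 ≤ ε' k)
    (hdecayLin : ∀ g ∈ W, ∀ (k : ℕ) (U : Bg) (X : C.Dom), C.scale X = k + 1 → ∀ γ' ∈ Γ.vol X,
      ∫ ω, ‖pre k (g k) U γ' ω‖ * Real.exp (boxExponent c pt β k (g k) U γ' ω) ∂(μ k (g k) U γ') ≤
        ε' k * Real.exp (-(a' * (linSize γ' : ℝ))))
    (ha₁ : 0 ≤ a₁) (ha'' : 0 ≤ a'')
    (hrate : (2:ℝ) ^ ν * Real.log 2 + Real.log (8 * ν) ≤ a' - a'' - 2 ^ ν * (a₁ + Real.log 2))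
    (hsmall : ∀ k, ((D : ℝ) + 1) * (2 * ε' k) * Real.exp (a'' * (ν + 1) + 2 ^ ν * (a₁ + Real.log 2)) *
      2 ^ (ν + 1 + 2 ^ ν) ≤ a₁)
    (hℓ : 0 ≤ ℓ) (hlam : ∀ k, lam k ≤ ℓ) :
    TermSize E W κ Nsz ∧
      NE9 E W κ (prodModuli ℓ fun _ => ω + 4 * lipbar * (a₁ * Real.exp (-(a'' * (ν + 1)))) * cQ) ∧
        FadingMemory (ℓ / (ω + 4 * lipbar * (a₁ * Real.exp (-(a'' * (ν + 1)))) * cQ))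
          (ω + 4 * lipbar * (a₁ * Real.exp (-(a'' * (ν + 1)))) * cQ)
          (prodModuli ℓ fun _ => ω + 4 * lipbar * (a₁ * Real.exp (-(a'' * (ν + 1)))) * cQ) := by
  have hlipbar : 0 ≤ lipbar := (hlip 0).le.trans (hlipb 0)
  have hpos : 0 < ω + 4 * lipbar * (a₁ * Real.exp (-(a'' * (ν + 1)))) * cQ := by
    have h2 : 0 ≤ 4 * lipbar * (a₁ * Real.exp (-(a'' * (ν + 1)))) * cQ := by positivity
    linarith
  have hprof := channelSizeAtStepNN_pieceG_profile hsrc hPiece hLev hKp hO1 hgain hcQ hω.le Adm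
  exact torus_termSize_ne9_and_fadingMemory_of_linSizeDischargers Γ ρ h0 hAdm hres (channelAdditive_piece Pc Adm)
    (channelStepSum_piece hsrc Adm) hprof.1 hfac hlast hρ hΨ hexpl hbase hNsucc hNnn hbox hpre hc hpt hlip hlipb hint₀ hmeet hα4
    ha hliplb hlin hdomconn hdominj hXconn hcmp hε' hdecayLin ha₁ ha'' hrate hsmall hℓ hcQ hω.le hpos hlam
    (fun k j hjk => ⟨mul_nonneg hcQ (agePow_nonneg hω.le k j), hprof.2.1 k j hjk⟩)

/-- **E5′-πβ — THE (4.30)-SPECIES: `ω = L^{−β}`, `β > 0` THE HÖLDER EXPONENT OF [I] (3.32)/(4.18)** (owner ruling l.7710 (E):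
«RATE LETTER ω := L^{−α} (α = β < 1 for the (4.30)-species), NOT L⁻¹»; [I] p. 288 «with a positive β … the power 4 + β instead of
5»; (0.30) «≦ O(1)(1 − L^{−α})⁻¹»): §1′ at `ω := L^{−β}` (real power), `0 < L^{−β} < 1` by `NE9Lemma1Gain.rpow_neg_pos_lt_one`.
Rate letter **`μ_β = L^{−β} + 4·lipbar·(a₁·e^{−a″(ν+1)})·c_Q`**; the ℓ⁵/`ω = L⁻¹` face E5′-π above is the DISPLAYED fifth-order
species ([II] p. 8 l. 9–10) — TRUE, but not the instance the (4.30)-terms need. [cite: Balaban1987RG1, (0.29)-(0.30) p.258, (4.18) p.285, p.288; Balaban1988RG2Cluster, p.8] -/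
theorem torus_termSize_ne9_and_fadingMemory_of_linSizeDischargers_pieceHolder
    (Γ : CubeChart C (Fin ν → ZMod N) (torusAdj ν N) D) {ι αi βi γi : Type} (Pc : PieceData C Bg ι αi βi γi)
    {E : Functional C Bg} {W : Set (ℕ → ℝ)} {Adm : Set (Bg → C.Dom → ℝ)} {Ψ : ℕ → ℝ → (ι → ℝ) → Bg → C.Dom → ℝ}
    {μ : ℕ → ℝ → Bg → Finset (Fin ν → ZMod N) → Measure Ω} {pre : ℕ → ℝ → Bg → Finset (Fin ν → ZMod N) → Ω → ℂ}
    {c : ℕ → ℝ → Bg → Finset (Fin ν → ZMod N) → Ω → F → ℂ}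
    {pt : ℕ → ℝ → Bg → Finset (Fin ν → ZMod N) → Ω → F → Sp} {β : ℕ → Sp → ℝ}
    {dom : ℕ → Finset (Fin ν → ZMod N) → F → Finset (Fin ν → ZMod N)}
    {lip ε' α4 : ℕ → ℝ} {a₁ a'' κ κ₁ d0 O1 cQ L βg lipbar ℓ a a' : ℝ} {Kp : ℕ → ι → ℝ} {gain : ℕ → ℕ → ℝ}
    {lam p₀ Nsz : ℕ → ℝ}
    (ρ : ℕ → (ι → ℝ) → (Sp →ᵇ ℂ))
    (h0 : ScaleZeroFree E W) (hAdm : AdmissibleTerms E W Adm) (hres : AdmRestrict Adm)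
    -- the (4.30)-species: block size L > 1, Hölder exponent β > 0, gain counted against `c_Q·(L^{−β})^{k−j}`
    (hL1 : 1 < L) (hβ : 0 < βg) (hsrc : SrcScale Pc) (hPiece : PieceBoundG Pc κ κ₁ d0 Kp gain)
    (hLev : LevelCountsG Pc κ κ₁ O1 cQ gain (agePow (L ^ (-βg))))
    (hKp : ∀ k y, 0 ≤ Kp k y) (hO1 : 0 ≤ O1) (hgain : ∀ k j, 0 ≤ gain k j) (hcQ : 0 ≤ cQ)
    -- E5′'s remaining recursion-side binders at `T := pieceChannel Pc`, `τ := tauOfG cQ (agePow (L^{−β}))`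
    (hfac : Factorises E W (pieceChannel Pc) Ψ) (hlast : LastCouplingLipschitz E W (pieceChannel Pc) Ψ κ lam)
    (hρ : ∀ (k : ℕ) (Q Q' : ι → ℝ) (M : ℝ), (∀ y, |Q y - Q' y| ≤ weightOf Pc κ₁ d0 O1 Kp k y * M) → ‖ρ k Q - ρ k Q'‖ ≤ M)
    (hΨ : ∀ (k : ℕ) (s : ℝ) (Q Q' : ι → ℝ) (U : Bg) (X : C.Dom),
      Ψ k s Q U X - Ψ k s Q' U X =
        (Γ.geom.newTerm (Γ.geom.avgExpLinearAct μ pre fun k s U γ ω => evalFunctional (c k s U γ ω) (pt k s U γ ω))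
            k s U X (ρ k Q) -
          Γ.geom.newTerm (Γ.geom.avgExpLinearAct μ pre fun k s U γ ω => evalFunctional (c k s U γ ω) (pt k s U γ ω))
            k s U X (ρ k Q')).re)
    (hexpl : ∀ g ∈ W, ∀ (k : ℕ) (Q : ι → ℝ) (U : Bg) (X : C.Dom), C.scale X = k + 1 →
      |Ψ k (g k) Q U X -
          (Γ.geom.newTerm (Γ.geom.avgExpLinearAct μ pre fun k s U γ ω => evalFunctional (c k s U γ ω) (pt k s U γ ω))
            k (g k) U X (ρ k Q)).re| ≤ Real.exp (-(κ * C.d X)) * p₀ k)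
    (hbase : ∀ g ∈ W, ∀ (U : Bg) (X : C.Dom), C.scale X = 0 → |E g U X| ≤ Real.exp (-(κ * C.d X)) * Nsz 0)
    (hNsucc : ∀ j, p₀ j + a₁ * Real.exp (-(a'' * (ν + 1))) ≤ Nsz (j + 1)) (hNnn : ∀ j, 0 ≤ Nsz j)
    (hbox : ∀ (k : ℕ) (Q : ι → ℝ),
      (∀ y, |Q y| ≤ weightOf Pc κ₁ d0 O1 Kp k y * sizeRadius (tauOfG cQ (agePow (L ^ (-βg)))) Nsz k) → ∀ x, ‖ρ k Q x‖ ≤ β k x)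
    (hpre : ∀ k s U γ, AEStronglyMeasurable (pre k s U γ) (μ k s U γ))
    (hc : ∀ k s U γ Y, AEStronglyMeasurable (fun ω => c k s U γ ω Y) (μ k s U γ))
    (hpt : ∀ k s U γ Y, Measurable fun ω => pt k s U γ ω Y) (hlip : ∀ k, 0 < lip k) (hlipb : ∀ k, lip k ≤ lipbar)
    (hint₀ : ∀ k s U γ, Integrable (fun ω => ‖pre k s U γ ω‖ * Real.exp (boxExponent c pt β k s U γ ω)) (μ k s U γ))
    (hmeet : ∀ k s U (γ : Finset (Fin ν → ZMod N)) ω Y, c k s U γ ω Y ≠ 0 → ∃ x ∈ γ, x ∈ dom k γ Y)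
    (hα4 : ∀ k, 0 ≤ α4 k) (ha : (2:ℝ) ^ ν * Real.log 2 + Real.log (8 * ν) ≤ a)
    (hliplb : ∀ k, α4 k * 2 ^ (ν + 1 + 2 ^ ν) ≤ lip k)
    (hlin : ∀ k s U (γ : Finset (Fin ν → ZMod N)) ω Y,
      ‖c k s U γ ω Y‖ ≤ α4 k * Real.exp (-(a * (linSize (dom k γ Y) : ℝ))))
    (hdomconn : ∀ k (γ : Finset (Fin ν → ZMod N)) Y, (dom k γ Y).Nonempty →
      ∃ b ∈ dom k γ Y, Polymer.IsConn (torusAdj ν N) (dom k γ Y) b)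
    (hdominj : ∀ k (γ : Finset (Fin ν → ZMod N)), Set.InjOn (dom k γ) {Y | (dom k γ Y).Nonempty})
    (hXconn : ∀ X, ∃ b, Polymer.IsConn (torusAdj ν N) (Γ.cubes X) b)
    (hcmp : ∀ X, κ * C.d X ≤ a'' * (linSize (Γ.cubes X) : ℝ))
    (hε' : ∀ k, 0 ≤ ε' k)
    (hdecayLin : ∀ g ∈ W, ∀ (k : ℕ) (U : Bg) (X : C.Dom), C.scale X = k + 1 → ∀ γ' ∈ Γ.vol X,
      ∫ ω, ‖pre k (g k) U γ' ω‖ * Real.exp (boxExponent c pt β k (g k) U γ' ω) ∂(μ k (g k) U γ') ≤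
        ε' k * Real.exp (-(a' * (linSize γ' : ℝ))))
    (ha₁ : 0 ≤ a₁) (ha'' : 0 ≤ a'')
    (hrate : (2:ℝ) ^ ν * Real.log 2 + Real.log (8 * ν) ≤ a' - a'' - 2 ^ ν * (a₁ + Real.log 2))
    (hsmall : ∀ k, ((D : ℝ) + 1) * (2 * ε' k) * Real.exp (a'' * (ν + 1) + 2 ^ ν * (a₁ + Real.log 2)) *
      2 ^ (ν + 1 + 2 ^ ν) ≤ a₁)
    (hℓ : 0 ≤ ℓ) (hlam : ∀ k, lam k ≤ ℓ) :
    TermSize E W κ Nsz ∧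
      NE9 E W κ (prodModuli ℓ fun _ => L ^ (-βg) + 4 * lipbar * (a₁ * Real.exp (-(a'' * (ν + 1)))) * cQ) ∧
        FadingMemory (ℓ / (L ^ (-βg) + 4 * lipbar * (a₁ * Real.exp (-(a'' * (ν + 1)))) * cQ))
          (L ^ (-βg) + 4 * lipbar * (a₁ * Real.exp (-(a'' * (ν + 1)))) * cQ)
          (prodModuli ℓ fun _ => L ^ (-βg) + 4 * lipbar * (a₁ * Real.exp (-(a'' * (ν + 1)))) * cQ) :=
  torus_termSize_ne9_and_fadingMemory_of_linSizeDischargers_pieceGain Γ Pc ρ h0 hAdm hres hsrc hPiece hLev hKp hO1 hgain hcQ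
    (rpow_neg_pos_lt_one hL1 hβ).1 hfac hlast hρ hΨ hexpl hbase hNsucc hNnn hbox hpre hc hpt hlip hlipb hint₀ hmeet hα4 ha hliplb
    hlin hdomconn hdominj hXconn hcmp hε' hdecayLin ha₁ ha'' hrate hsmall hℓ hlam

end Gain

/-! ## §4 Leaf N2 on the (4.30)-species letters: `ω = L^{−β}`, `τ̄ = c_Q` -/

/-- **FADING ON E5′-πβ IS A LOWER BOUND ON THE DECAY-WEIGHT RATE** (N2-ter §C `fade_iff_log_lt_E5'` BY NAME at `ω := L^{−β}`,
`τ̄ := c_Q`): for `L > 1`, `β > 0` and a positive product, `μ_β < 1 ↔ log(4·lipbar·a₁·c_Q / (1 − L^{−β})) < a″(ν+1)`.  The gap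
`1 − L^{−β}` is positive ONLY for `β > 0` — p. 288's «positive β» enters strictly. [cite: Balaban1987RG1, (0.30) p.258, p.288, Thm 3 p.264; Balaban1988RG2Cluster, p.18 text] -/
theorem fade_pieceHolder_iff_log_lt {ν : ℕ} {L βg lipbar a₁ a'' cQ : ℝ} (hL : 1 < L) (hβ : 0 < βg) (hlip : 0 < lipbar)
    (ha₁ : 0 < a₁) (hcQ : 0 < cQ) :
    L ^ (-βg) + 4 * lipbar * (a₁ * Real.exp (-(a'' * (ν + 1)))) * cQ < 1 ↔
      Real.log (4 * lipbar * a₁ * cQ / (1 - L ^ (-βg))) < a'' * (ν + 1) :=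
  fade_iff_log_lt_E5' (by positivity) (rpow_neg_pos_lt_one hL hβ).2

/-- **«κ SUFFICIENTLY LARGE» SUFFICES ON E5′-πβ** (with the face's ADDITIVE `κ ≤ a″`; §C `rate_antitone_E5'` BY NAME). [folklore] -/
theorem fade_pieceHolder_of_kappa_threshold {ν : ℕ} {L βg lipbar a₁ a'' cQ κ : ℝ} (hL : 1 < L) (hβ : 0 < βg)
    (hlip : 0 < lipbar) (ha₁ : 0 < a₁) (hcQ : 0 < cQ) (hκa : κ ≤ a'')
    (hthr : Real.log (4 * lipbar * a₁ * cQ / (1 - L ^ (-βg))) < κ * (ν + 1)) :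
    L ^ (-βg) + 4 * lipbar * (a₁ * Real.exp (-(a'' * (ν + 1)))) * cQ < 1 :=
  (rate_antitone_E5' (by positivity) hκa).trans_lt ((fade_pieceHolder_iff_log_lt hL hβ hlip ha₁ hcQ).2 hthr)

/-- **NECESSARY POLYNOMIAL SMALLNESS ON E5′-πβ** (§C `fade_necessary_E5'` BY NAME at `ω := L^{−β}`, `τ̄ := c_Q`):
`μ_β < 1` ⇒ `8(D+1)·2^{2^ν}·(2^(ν+1+2^ν))²·α4·ε′·c_Q < 1 − L^{−β}`. [folklore] -/
theorem fade_necessary_pieceHolder {ν D : ℕ} {a'' a₁ ε' α4 lip lipbar L βg cQ : ℝ} (hα4 : 0 ≤ α4) (hε' : 0 ≤ ε')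
    (hcQ : 0 ≤ cQ) (ha₁ : 0 ≤ a₁) (hliplb : α4 * 2 ^ (ν + 1 + 2 ^ ν) ≤ lip) (hlipb : lip ≤ lipbar)
    (hsmall : ((D : ℝ) + 1) * (2 * ε') * Real.exp (a'' * (ν + 1) + 2 ^ ν * (a₁ + Real.log 2)) * 2 ^ (ν + 1 + 2 ^ ν) ≤ a₁)
    (hfade : L ^ (-βg) + 4 * lipbar * (a₁ * Real.exp (-(a'' * (ν + 1)))) * cQ < 1) :
    8 * ((D : ℝ) + 1) * (2:ℝ) ^ (2 ^ ν) * (2 ^ (ν + 1 + 2 ^ ν)) ^ 2 * α4 * ε' * cQ < 1 - L ^ (-βg) :=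
  fade_necessary_E5' hα4 hε' hcQ ha₁ hliplb hlipb hsmall hfade

/-- **THE GAP IS ANTITONE IN β**: for `L > 1` and `β ≤ β′`, `1 − L^{−β} ≤ 1 − L^{−β′}` — a threshold or a polynomial smallness
established at the SMALLEST declared Hölder exponent holds on the whole declared range `β ≤ β′` ([I] (4.18) «0 ≦ β ≦ β₀ < 1»).
[cite: Balaban1987RG1, (4.18) p.285] -/
theorem holderGap_antitone {L βg βg' : ℝ} (hL : 1 < L) (hββ : βg ≤ βg') : 1 - L ^ (-βg) ≤ 1 - L ^ (-βg') := by
  have h : L ^ (-βg') ≤ L ^ (-βg) := Real.rpow_le_rpow_of_exponent_le hL.le (by linarith)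
  linarith

/-- **AT β = 0 NOTHING FADES** (tightness, our inequality): `L^{−0} = 1`, so `μ_0 ≥ 1` for any nonnegative product — the
strict positivity of p. 288's β is what the N2 side condition lives on. [folklore] -/
theorem not_fade_at_holder_zero {ν : ℕ} {L lipbar a₁ a'' cQ : ℝ} (hlip : 0 ≤ lipbar) (ha₁ : 0 ≤ a₁) (hcQ : 0 ≤ cQ) :
    ¬ (L ^ (-(0:ℝ)) + 4 * lipbar * (a₁ * Real.exp (-(a'' * (ν + 1)))) * cQ < 1) := by
  rw [neg_zero, Real.rpow_zero]
  have : 0 ≤ 4 * lipbar * (a₁ * Real.exp (-(a'' * (ν + 1)))) * cQ := by positivity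
  linarith

end Summit.QuantumFields.BalabanUV.T4Continuum.NE9LinSizeEndPieceGain

end
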